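import Literature.Probability.RandomPlanarGeometry.RadoContinuity
import Literature.Probability.RandomPlanarGeometry.ConformalRestrictionCovariance
import Literature.Probability.RandomPlanarGeometry.LocalMartingaleProofs
import HarnessLib

/-!
# Radó continuity of the chordal SLE_κ families, unconditionally

Proof-only leaf for `Literature.Probability.RandomPlanarGeometry.ChordalFamily.IsRadoContinuous`
(`RadoContinuity.lean`, definition item `defn-ChordalFamily.IsRadoContinuous`, route
`CriticalPhenomena/SAWRestrictionDescent`). The definition file proves
`ChordalFamily.isRadoContinuous_of_isSLELaw` with three named facts of the tree as explicit
hypotheses, to keep their import cones out of a file that route items import; here the three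
discharges are plugged in:

* `isProjectiveLimit_preWienerMeasure_holds` (`LocalMartingaleProofs.lean`: Kolmogorov extension,
  the Wiener measure is a probability measure);
* `IsSLELaw.conformalCovariance_holds` (`ConformalRestrictionCovariance.lean`: Lawler 2005 §6.1,
  conformal covariance of chordal SLE_κ between Dobrushin domains, from uniqueness in law and
  Carathéodory);
* `JordanDomain.mapsTo_boundaryExtension_holds` (`CaratheodoryHalfPlaneProofs.lean`: Pommerenke
  1992 Thm. 2.1/2.6).

Result: a chordal family all of whose laws are chordal SLE_κ laws (any `κ`) is Radó-continuous —
the remark of item `stmt-CriticalPhenomena-7305` ("trivially implied by the conjunct: SLE_{8/3}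
is conformally covariant, so `P(D_n) = (Φ_n)_* P(D) → Φ_* P(D) = P(D')`"), now a theorem with no
hypotheses beyond `∀ D, IsSLELaw κ D (Q D)`.

## References

* G. F. Lawler, *Conformally Invariant Processes in the Plane*, AMS (2005), §6.1 p. 149, §6.3.
* Ch. Pommerenke, *Boundary Behaviour of Conformal Maps*, Springer (1992), §2.3 Thm. 2.11 (Radó).
-/

noncomputable section

open scoped NNReal

namespace Literature.Probability.RandomPlanarGeometry

/-- **Every family of chordal SLE_κ laws is Radó-continuous** (unconditional form of
`ChordalFamily.isRadoContinuous_of_isSLELaw`): if `Q D` is a chordal SLE_κ law in `(D; a, b)` for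
every Dobrushin domain `D`, then `Q.IsRadoContinuous` — along `Φ_n → Φ` uniformly on `closure D`
(conformal on `D`, injective on the closure) the laws `Q (Φ_n D) = (Φ_n)_* (Q D)` converge weakly
to `Q (Φ D) = Φ_* (Q D)`. Lawler (2005), §6.1 p. 149 (chordal SLE_κ in a domain as a conformal
image) with dominated convergence on curve space. [cite: Lawler2005, §6.1 p. 149] -/
theorem ChordalFamily.isRadoContinuous_of_forall_isSLELaw {κ : ℝ≥0} {Q : ChordalFamily}
    (hQ : ∀ D : DobrushinDomain, IsSLELaw κ D (Q D)) : Q.IsRadoContinuous :=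
  ChordalFamily.isRadoContinuous_of_isSLELaw isProjectiveLimit_preWienerMeasure_holds
    IsSLELaw.conformalCovariance_holds JordanDomain.mapsTo_boundaryExtension_holds hQ

/-- In particular two chordal SLE_κ families agree on Dobrushin domains with the same carrier and
marked points, and each depends on `D` only through `(carrier, a, b)`. [folklore] -/
theorem ChordalFamily.eq_of_isSLELaw_of_carrier_eq {κ : ℝ≥0} {Q : ChordalFamily}
    (hQ : ∀ D : DobrushinDomain, IsSLELaw κ D (Q D)) {D₁ D₂ : DobrushinDomain}
    (hc : D₁.carrier = D₂.carrier) (h0 : D₁.pt 0 = D₂.pt 0) (h1 : D₁.pt 1 = D₂.pt 1) :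
    Q D₁ = Q D₂ := by
  haveI : Fact Process.isProjectiveLimit_preWienerMeasure := ⟨isProjectiveLimit_preWienerMeasure_holds⟩
  haveI := (hQ D₁).isProbabilityMeasure
  haveI := (hQ D₂).isProbabilityMeasure
  exact (ChordalFamily.isRadoContinuous_of_forall_isSLELaw hQ).eq_of_carrier_eq hc h0 h1

end Literature.Probability.RandomPlanarGeometry

end
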